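import Summits.HodgeConjecture.HodgeConjecture.Theorems.TropicalWeilObstructionTropicalWeilVanishingFrameSpanWeilPlane
import HarnessLib

/-!
# Route `TropicalWeilObstruction` (Kontsevich's tropical test — NEGATION SINK, exploration, no summit claim):
# the frame span of an effective tropical `4`-cycle on a very general tropical Weil eightfold — III. rank and counts

Negation-sink bookkeeping of the cell `pub-hodge-tropical` (seat tropical-1 gen 6); part III of four (master identity in
`…FrameSpanMaster`, Weil plane / line bound in `…FrameSpanWeilPlane`, seeds in `…FrameSpanSeeds`). THE DIRECTION BOUND for a
NON-EMPTY effective tropical `4`-cycle `Z` on `ℝ⁸/Qℤ⁸`, `Q ≻ 0`, `QJ = JQ`, `IsWeilGeneric 4 Q`: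
* `finrank_span_frames_ge` — the Plücker vectors of the cells span `≥ 69` of the `70` dimensions of `⋀⁴ℝ⁸` (the annihilator
  in `ℝ⁷⁰` is at most a line: `exists_testVector`, `span_insert_eq_top_of_testVector`); `card_image_pluckerCoord_ge`,
  `numCells_ge` — `≥ 69` pairwise distinct Plücker vectors and `≥ 69` cells;
* `restricted_annihilator_eq_zero_of_offBoundary`, `span_restrictedFrames_eq_top_of_offBoundary`,
  `finrank_span_frames_ge_of_offBoundary` — `≥ 70` (all of `⋀⁴ℝ⁸`, `≥ 70` cells) whenever the K3 coordinates are OFF the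
  boundary circle `64(q₁²+q₂²) = q₀²` of the calibration cone (decided sums `Σ_r Ω(I_r)² = 0`, `Σ_r |Ω(I_r)|² = 16` give
  `z_c = 8 λ̄ z̄_c`): only calibrated classes (`|W| = μ`) can have a frame span of codimension one;
* `…_of_weilFunctional_eq_zero` — in particular `≥ 70` when `W(Z) = 0`, i.e. for every non-empty effective cycle if the open
  crux K1 (`TropicalWeilVanishing`, stmt-HodgeConjecture-18478) holds.

HONEST STATUS. A size constraint; it decides nothing about K1 (open problem) or about the Hodge conjecture. No definition,
no named fact, no sorry. References: [Zharkov2020TropicalWeil] I. Zharkov, arXiv:2002.02347, §2 (pp. 2–4);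
[MikhalkinZharkov2014Eigenwave] G. Mikhalkin, I. Zharkov, LN UMI 15 (2014), Def. 4.2, Prop. 4.3, Thm. 5.4.
-/


set_option linter.dupNamespace false

noncomputable section

open scoped BigOperators
open Matrix
open Literature.AlgebraicGeometry.Tropical
open Summit.HodgeConjecture.HodgeConjecture.Theorems.TropicalHodgeBound

namespace Summit.HodgeConjecture.HodgeConjecture.Theorems.TropicalWeilVanishing.FrameSpan

/-! ## §0 Display-only notation (the K3 skeleton's local definitions, verbatim bodies; nothing is defined) -/
/-- The skeleton's `thetaClass n Q`. -/
local notation3 (prettyPrint := false) "θ⟦" n "⟧" Q:max =>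
  (fun S S' : Fin n → Fin (2 * n) => Matrix.det (Matrix.submatrix Q S S'))

/-- The skeleton's `omegaFrame n` (`Ω = Pᴴ`). -/
local notation3 (prettyPrint := false) "Ω⟦" n "⟧" =>
  (Matrix.of fun (a : Fin (2 * n)) (b : Fin n) =>
    (if (a : ℕ) = (b : ℕ) then (1 : ℂ) else 0) - (if (a : ℕ) = (b : ℕ) + n then Complex.I else 0))

/-- The skeleton's `weilClassC n Q` (`w(Q) = (⋀ⁿQ ⊗ 1)(Ω ⊗ Ω)`). -/
local notation3 (prettyPrint := false) "wC⟦" n "⟧" Q:max =>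
  (fun S S' : Fin n → Fin (2 * n) =>
    Matrix.det (Matrix.submatrix (Matrix.map Q ((↑) : ℝ → ℂ) * Ω⟦n⟧) S id) *
      Matrix.det (Matrix.submatrix (Ω⟦n⟧) S' id))

/-- The skeleton's `weilClassRe n Q` (`w₁ = Re w`). -/
local notation3 (prettyPrint := false) "wRe⟦" n "⟧" Q:max =>
  (fun S S' : Fin n → Fin (2 * n) => Complex.re ((wC⟦n⟧ Q) S S'))

/-- The skeleton's `weilClassIm n Q` (`w₂ = Im w`). -/
local notation3 (prettyPrint := false) "wIm⟦" n "⟧" Q:max =>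
  (fun S S' : Fin n → Fin (2 * n) => Complex.im ((wC⟦n⟧ Q) S S'))

/-- NEW display-only notation: the `Ω`-minor `Ω(S) := det Ω⟦4⟧[S,·] ∈ ℤ[i]` of a word `S` (the value of
`dz̄₁ ∧ dz̄₂ ∧ dz̄₃ ∧ dz̄₄` on `e_S`). Nothing is defined. -/
local notation3 (prettyPrint := false) "Ωm" S:max => (Matrix.det (Matrix.submatrix (Ω⟦4⟧) S id))

/-- **A test vector killing the annihilator.** There is `v ∈ ℝ⁷⁰` such that the only `c ∈ ℝ⁷⁰` orthogonal to all
restricted Plücker vectors of `Z` and to `v` is `0` (the annihilator is at most a line). [folklore] -/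
theorem exists_testVector (Q : Matrix (Fin (2 * 4)) (Fin (2 * 4)) ℝ) (hQ : Q.PosDef)
    (hJ : Q * weilJ 4 = weilJ 4 * Q) (hgen : IsWeilGeneric 4 Q) (Z : TropicalTorusCycle (2 * 4) 4 Q)
    (hZ : 0 < Z.numCells) :
    ∃ v : Fin 70 → ℝ, ∀ c : Fin 70 → ℝ,
      (∀ σ, ∑ r : Fin 70, ((pluckerCoord (Z.cell σ).frame (Chk.wordOfRank r) : ℤ) : ℝ) * c r = 0) →
      ∑ r, v r * c r = 0 → c = 0 := by
  classical
  by_cases h : ∃ c₀ : Fin 70 → ℝ,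
      (∀ σ, ∑ r : Fin 70, ((pluckerCoord (Z.cell σ).frame (Chk.wordOfRank r) : ℤ) : ℝ) * c₀ r = 0) ∧ c₀ ≠ 0
  · obtain ⟨c₀, hc₀, hne⟩ := h
    refine ⟨c₀, fun c hc hv => ?_⟩
    obtain ⟨t, ht, hdep⟩ := annihilator_pairwise_dependent Q hQ hJ hgen Z hZ c₀ c hc₀ hc
    by_cases ht2 : t.2 = 0
    · exfalso
      apply hne
      have ht1 : t.1 ≠ 0 := fun h1 => ht (Prod.ext h1 ht2)
      rw [ht2, zero_smul, add_zero] at hdep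
      exact (smul_eq_zero.mp hdep).resolve_left ht1
    · have hc' : c = (-(t.1 / t.2)) • c₀ := by
        ext r
        have e := congrFun hdep r
        simp only [Pi.add_apply, Pi.smul_apply, smul_eq_mul, Pi.zero_apply] at e
        simp only [Pi.smul_apply, smul_eq_mul]
        field_simp
        linarith
      have hsum : 0 < ∑ r, c₀ r * c₀ r := by
        obtain ⟨r₀, hr₀⟩ : ∃ r, c₀ r ≠ 0 := by
          by_contra hh
          push Not at hh
          exact hne (funext hh)
        exact lt_of_lt_of_le (mul_self_pos.mpr hr₀)
          (Finset.single_le_sum (fun r _ => mul_self_nonneg (c₀ r)) (Finset.mem_univ r₀))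
      rw [hc'] at hv
      simp only [Pi.smul_apply, smul_eq_mul] at hv
      have h0 : -(t.1 / t.2) * ∑ r, c₀ r * c₀ r = 0 := by
        rw [Finset.mul_sum, ← hv]
        exact Finset.sum_congr rfl fun r _ => by ring
      have ht12 : -(t.1 / t.2) = 0 := (mul_eq_zero.mp h0).resolve_right hsum.ne'
      rw [hc', ht12, zero_smul]
  · push Not at h
    exact ⟨0, fun c hc _ => h c hc⟩

/-- From a killing test vector to a spanning statement in `ℝ⁷⁰`. [folklore] -/
theorem span_insert_eq_top_of_testVector (S : Set (Fin 70 → ℝ)) (v : Fin 70 → ℝ)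
    (h : ∀ c : Fin 70 → ℝ, (∀ u ∈ S, ∑ r, u r * c r = 0) → ∑ r, v r * c r = 0 → c = 0) :
    Submodule.span ℝ (insert v S) = ⊤ := by
  classical
  by_contra hne
  obtain ⟨φ, hφ0, hle⟩ := Submodule.exists_le_ker_of_lt_top _ (lt_top_iff_ne_top.mpr hne)
  set c : Fin 70 → ℝ := fun r => φ (fun j => if r = j then 1 else 0) with hc
  have hφ : ∀ u : Fin 70 → ℝ, φ u = ∑ r, u r * c r := by
    intro u
    rw [LinearMap.pi_apply_eq_sum_univ φ u]
    simp only [smul_eq_mul, hc]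
  have hker : ∀ u ∈ insert v S, ∑ r, u r * c r = 0 := by
    intro u hu
    rw [← hφ u]
    exact LinearMap.mem_ker.mp (hle (Submodule.subset_span hu))
  have hc0 : c = 0 := h c (fun u hu => hker u (Set.mem_insert_of_mem v hu)) (hker v (Set.mem_insert v S))
  apply hφ0
  apply LinearMap.ext
  intro u
  rw [hφ u, hc0]
  simp

/-- **FRAME-SPAN THEOREM (rank form).** On a very general principally polarised tropical Weil eightfold, the Plücker
vectors `p_σ ∈ ⋀⁴ℤ⁸` of the cells of a NON-EMPTY effective tropical `4`-cycle span a subspace of dimension `≥ 69` of the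
`70`-dimensional `⋀⁴ℝ⁸` (so the cells lie in `≥ 69` pairwise distinct rational `4`-planes; `70` off the cone boundary).
[cite: Zharkov2020TropicalWeil, §2] [cite: MikhalkinZharkov2014Eigenwave, Prop. 4.3 and Thm. 5.4] -/
theorem finrank_span_frames_ge (Q : Matrix (Fin (2 * 4)) (Fin (2 * 4)) ℝ) (hQ : Q.PosDef)
    (hJ : Q * weilJ 4 = weilJ 4 * Q) (hgen : IsWeilGeneric 4 Q) (Z : TropicalTorusCycle (2 * 4) 4 Q)
    (hZ : 0 < Z.numCells) :
    69 ≤ Module.finrank ℝ (Submodule.span ℝ (Set.range fun σ : Fin Z.numCells =>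
      fun S : Fin 4 → Fin (2 * 4) => ((pluckerCoord (Z.cell σ).frame S : ℤ) : ℝ))) := by
  classical
  obtain ⟨v, hv⟩ := exists_testVector Q hQ hJ hgen Z hZ
  set P : Fin Z.numCells → ((Fin 4 → Fin (2 * 4)) → ℝ) :=
    fun σ S => ((pluckerCoord (Z.cell σ).frame S : ℤ) : ℝ) with hP
  set ρ : ((Fin 4 → Fin (2 * 4)) → ℝ) →ₗ[ℝ] (Fin 70 → ℝ) :=
    LinearMap.funLeft ℝ ℝ (fun r : Fin 70 => Chk.wordOfRank r) with hρ
  have htop : Submodule.span ℝ (insert v (ρ '' Set.range P)) = ⊤ := by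
    refine span_insert_eq_top_of_testVector _ v fun c hc hvc => hv c (fun σ => ?_) hvc
    have hmem : ρ (P σ) ∈ ρ '' Set.range P := Set.mem_image_of_mem ρ (Set.mem_range_self σ)
    exact hc _ hmem
  have h70 : Module.finrank ℝ (Fin 70 → ℝ) = 70 := Module.finrank_fin_fun ℝ
  have h1 : 70 ≤ Module.finrank ℝ (Submodule.span ℝ ({v} : Set (Fin 70 → ℝ))) +
      Module.finrank ℝ (Submodule.span ℝ (ρ '' Set.range P)) := by
    have h := Submodule.finrank_add_le_finrank_add_finrank (Submodule.span ℝ ({v} : Set (Fin 70 → ℝ)))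
      (Submodule.span ℝ (ρ '' Set.range P))
    rw [← Submodule.span_union, Set.singleton_union, htop, finrank_top, h70] at h
    exact h
  have h2 : Module.finrank ℝ (Submodule.span ℝ ({v} : Set (Fin 70 → ℝ))) ≤ 1 := by
    simpa using finrank_span_le_card ({v} : Set (Fin 70 → ℝ))
  have h3 : Module.finrank ℝ (Submodule.span ℝ (ρ '' Set.range P)) ≤
      Module.finrank ℝ (Submodule.span ℝ (Set.range P)) := by
    rw [Submodule.span_image]
    exact Submodule.finrank_map_le ρ _
  omega

/-- **At least `69` pairwise distinct Plücker vectors** (hence 4-directions) among the cells of a non-empty effective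
tropical `4`-cycle on a very general tropical Weil eightfold. [cite: Zharkov2020TropicalWeil, §2]
[cite: MikhalkinZharkov2014Eigenwave, Prop. 4.3] -/
theorem card_image_pluckerCoord_ge (Q : Matrix (Fin (2 * 4)) (Fin (2 * 4)) ℝ) (hQ : Q.PosDef)
    (hJ : Q * weilJ 4 = weilJ 4 * Q) (hgen : IsWeilGeneric 4 Q) (Z : TropicalTorusCycle (2 * 4) 4 Q)
    (hZ : 0 < Z.numCells) :
    69 ≤ (Finset.univ.image fun σ : Fin Z.numCells => pluckerCoord (Z.cell σ).frame).card := by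
  classical
  have h := finrank_span_frames_ge Q hQ hJ hgen Z hZ
  set P : Fin Z.numCells → ((Fin 4 → Fin (2 * 4)) → ℝ) :=
    fun σ S => ((pluckerCoord (Z.cell σ).frame S : ℤ) : ℝ) with hP
  have h1 : Module.finrank ℝ (Submodule.span ℝ (Set.range P)) ≤ (Set.range P).toFinset.card :=
    finrank_span_le_card _
  rw [Set.toFinset_range] at h1
  have h2 : (Finset.univ.image P).card ≤ (Finset.univ.image fun σ : Fin Z.numCells => pluckerCoord (Z.cell σ).frame).card := by
    have e : Finset.univ.image P = (Finset.univ.image fun σ : Fin Z.numCells => pluckerCoord (Z.cell σ).frame).image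
        (fun g : (Fin 4 → Fin (2 * 4)) → ℤ => fun S => ((g S : ℤ) : ℝ)) := by
      rw [Finset.image_image]
      rfl
    rw [e]
    exact Finset.card_image_le
  omega

/-- **At least `69` cells.** A non-empty effective tropical `4`-cycle on a very general principally polarised tropical
Weil eightfold has at least `69` cells (indeed `69` cells with pairwise distinct `4`-directions); so is every UNOBSTRUCTED
seed for the open crux K1 (`numCells_ge_of_linearlyRealisable`). [cite: Zharkov2020TropicalWeil, §2]
[cite: MikhalkinZharkov2014Eigenwave, Def. 4.2 and Prop. 4.3] -/
theorem numCells_ge (Q : Matrix (Fin (2 * 4)) (Fin (2 * 4)) ℝ) (hQ : Q.PosDef)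
    (hJ : Q * weilJ 4 = weilJ 4 * Q) (hgen : IsWeilGeneric 4 Q) (Z : TropicalTorusCycle (2 * 4) 4 Q)
    (hZ : 0 < Z.numCells) : 69 ≤ Z.numCells := by
  classical
  have h := card_image_pluckerCoord_ge Q hQ hJ hgen Z hZ
  have h2 := Finset.card_image_le (s := (Finset.univ : Finset (Fin Z.numCells)))
    (f := fun σ : Fin Z.numCells => pluckerCoord (Z.cell σ).frame)
  simp only [Finset.card_univ, Fintype.card_fin] at h2
  omega

/-! ### Off the boundary of the calibration cone the frames span everything -/

/-- `Σ_r Ω(I_r)² = 0` over the `70` increasing words (decided in `ℤ[i]`; `ΩᵀΩ = 0`). [folklore] -/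
theorem sum_omegaMinorF_sq : ∑ r : Fin 70, Chk.omegaMinorF (Chk.wordOfRank r) * Chk.omegaMinorF (Chk.wordOfRank r) = 0 := by
  decide +kernel

/-- `Σ_r |Ω(I_r)|² = 16` over the `70` increasing words (decided in `ℤ[i]`; `ΩᴴΩ = 2·1`). [folklore] -/
theorem sum_omegaMinorF_mul_star :
    ∑ r : Fin 70, Chk.omegaMinorF (Chk.wordOfRank r) * star (Chk.omegaMinorF (Chk.wordOfRank r)) = 16 := by
  decide +kernel

/-- `Σ_r Ω(I_r)² = 0` in `ℂ`. [folklore] -/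
theorem sum_omega_sq : ∑ r : Fin 70, Ωm (Chk.wordOfRank r) * Ωm (Chk.wordOfRank r) = 0 := by
  have h := congrArg GaussianInt.toComplex sum_omegaMinorF_sq
  rw [map_sum, map_zero] at h
  simp_rw [map_mul, omegaMinorF_toComplex] at h
  exact h

/-- `Σ_r Ω(I_r) · conj Ω(I_r) = 16` in `ℂ`. [folklore] -/
theorem sum_omega_mul_conj :
    ∑ r : Fin 70, Ωm (Chk.wordOfRank r) * (starRingEnd ℂ) (Ωm (Chk.wordOfRank r)) = 16 := by
  have h := congrArg GaussianInt.toComplex sum_omegaMinorF_mul_star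
  rw [map_sum] at h
  simp_rw [map_mul, GaussianInt.toComplex_star, omegaMinorF_toComplex] at h
  rw [h]
  exact map_ofNat GaussianInt.toComplex 16

/-- **OFF THE CONE BOUNDARY THE RESTRICTED ANNIHILATOR IS TRIVIAL** (any `Q ≻ 0` with `QJ = JQ`; no genericity needed once the
class is written in K3's 3-space). If `cyc Z = q₀ θ₄(Q) + q₁ Re w(Q) + q₂ Im w(Q)` with `q₀ ≠ 0` and `64(q₁² + q₂²) ≠ q₀²`, then
no non-zero `c ∈ ℝ⁷⁰` is orthogonal to all restricted Plücker vectors: by the master identity `c = Re(λ z_c Ω̂)`,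
`λ = -(q₁ - iq₂)/q₀`, and re-insertion with `Σ_r Ω(I_r)² = 0`, `Σ_r |Ω(I_r)|² = 16` gives `z_c = 8 λ̄ z̄_c`, whence
`|z_c|² (1 - 64|λ|²) = 0`, i.e. `z_c = 0` off the boundary circle `64(q₁²+q₂²) = q₀²` of the calibration cone.
[cite: Zharkov2020TropicalWeil, §2] [cite: MikhalkinZharkov2014Eigenwave, Prop. 4.3 and Thm. 5.4] -/
theorem restricted_annihilator_eq_zero_of_offBoundary {Q : Matrix (Fin (2 * 4)) (Fin (2 * 4)) ℝ} (hQd : IsUnit Q.det)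
    (hJ : Q * weilJ 4 = weilJ 4 * Q) (Z : TropicalTorusCycle (2 * 4) 4 Q) (q0 q1 q2 : ℝ)
    (hq : TropicalTorusCycle.cyc Z = q0 • θ⟦4⟧ Q + q1 • wRe⟦4⟧ Q + q2 • wIm⟦4⟧ Q) (hq0 : q0 ≠ 0)
    (hoff : 64 * (q1 ^ 2 + q2 ^ 2) ≠ q0 ^ 2) (c : Fin 70 → ℝ)
    (hc : ∀ σ, ∑ r : Fin 70, ((pluckerCoord (Z.cell σ).frame (Chk.wordOfRank r) : ℤ) : ℝ) * c r = 0) : c = 0 := by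
  set lam : ℂ := -(((q1 : ℂ) - Complex.I * (q2 : ℂ)) / (q0 : ℂ)) with hlam
  set Ωv : Fin 70 → ℂ := fun r => Ωm (Chk.wordOfRank r) with hΩv
  obtain ⟨z, hz⟩ : ∃ z : ℂ, z = ∑ r, Ωv r * ((c r : ℝ) : ℂ) := ⟨_, rfl⟩
  -- the master identity on increasing words
  have key : ∀ t : Fin 70, c t = (lam * z * Ωv t).re := by
    intro t
    have hy : ∀ σ, ∑ S : Fin 4 → Fin (2 * 4), ((pluckerCoord (Z.cell σ).frame S : ℤ) : ℝ) *
        (∑ r : Fin 70, if S = Chk.wordOfRank r then c r else 0) = 0 :=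
      fun σ => by rw [sum_mul_lift]; exact hc σ
    have h := alt_eq_re_of_annihilates hQd hJ Z _ _ _ hq hq0
      (fun S => ∑ r : Fin 70, if S = Chk.wordOfRank r then c r else 0) hy (Chk.wordOfRank t)
    beta_reduce at h
    rw [alt_lift, sum_mul_lift_complex] at h
    rw [hz]
    exact h
  -- re-insertion: `2 z = lam P z + N conj(lam) conj(z)` with `P = 0`, `N = 16`
  have hterm : ∀ r, (2 : ℂ) * (Ωv r * (((lam * z * Ωv r).re : ℝ) : ℂ)) =
      lam * (Ωv r * Ωv r) * z + Ωv r * (starRingEnd ℂ) (Ωv r) * (starRingEnd ℂ) lam * (starRingEnd ℂ) z := by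
    intro r
    rw [Complex.re_eq_add_conj, map_mul, map_mul]
    ring
  have hz' : z = ∑ r, Ωv r * (((lam * z * Ωv r).re : ℝ) : ℂ) := by
    conv_lhs => rw [hz]
    exact Finset.sum_congr rfl fun r _ => by rw [← key r]
  have hE : 2 * z = 16 * (starRingEnd ℂ) lam * (starRingEnd ℂ) z := by
    calc 2 * z = ∑ r, (2 : ℂ) * (Ωv r * (((lam * z * Ωv r).re : ℝ) : ℂ)) := by
          conv_lhs => rw [hz']
          rw [Finset.mul_sum]
      _ = ∑ r, (lam * (Ωv r * Ωv r) * z + Ωv r * (starRingEnd ℂ) (Ωv r) * (starRingEnd ℂ) lam * (starRingEnd ℂ) z) :=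
          Finset.sum_congr rfl fun r _ => hterm r
      _ = lam * (∑ r, Ωv r * Ωv r) * z + (∑ r, Ωv r * (starRingEnd ℂ) (Ωv r)) * (starRingEnd ℂ) lam * (starRingEnd ℂ) z := by
          rw [Finset.sum_add_distrib, Finset.mul_sum, Finset.sum_mul, Finset.sum_mul, Finset.sum_mul]
      _ = 16 * (starRingEnd ℂ) lam * (starRingEnd ℂ) z := by
          rw [show (∑ r, Ωv r * Ωv r) = 0 from sum_omega_sq, show (∑ r, Ωv r * (starRingEnd ℂ) (Ωv r)) = 16 from
            sum_omega_mul_conj]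
          ring
  -- norms: `|z|² = 64 |lam|² |z|²`
  have hnorm : Complex.normSq z * (1 - 64 * Complex.normSq lam) = 0 := by
    have h1 : z = 8 * (starRingEnd ℂ) lam * (starRingEnd ℂ) z := by
      have := hE
      linear_combination (1 / 2 : ℂ) * this
    have h2 := congrArg Complex.normSq h1
    rw [map_mul, map_mul, Complex.normSq_conj, Complex.normSq_conj] at h2
    have h8 : Complex.normSq (8 : ℂ) = 64 := by norm_num [Complex.normSq_apply]
    rw [h8] at h2
    linear_combination h2
  have hlam2 : Complex.normSq lam = (q1 ^ 2 + q2 ^ 2) / q0 ^ 2 := by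
    rw [hlam, Complex.normSq_neg, Complex.normSq_div]
    have e1 : Complex.normSq ((q1 : ℂ) - Complex.I * (q2 : ℂ)) = q1 ^ 2 + q2 ^ 2 := by
      simp [Complex.normSq_apply]; ring
    have e2 : Complex.normSq (q0 : ℂ) = q0 ^ 2 := by rw [Complex.normSq_ofReal]; ring
    rw [e1, e2]
  have hfac : 1 - 64 * Complex.normSq lam ≠ 0 := by
    rw [hlam2]
    intro h0
    apply hoff
    have hq02 : q0 ^ 2 ≠ 0 := pow_ne_zero 2 hq0
    field_simp at h0
    linarith
  have hz0 : z = 0 := Complex.normSq_eq_zero.mp ((mul_eq_zero.mp hnorm).resolve_right hfac)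
  ext t
  rw [key t, hz0, mul_zero, zero_mul, Complex.zero_re, Pi.zero_apply]

/-- **Off the boundary: the restricted frames span `ℝ⁷⁰`** (`Q` invertible with `QJ = JQ`, a representation
`cyc Z = q₀θ₄(Q) + q₁Re w(Q) + q₂Im w(Q)` with `q₀ ≠ 0`, `64(q₁²+q₂²) ≠ q₀²` — at a Weil-generic `Q` K3 supplies it for
every effective `Z`, with `q₀ > 0` when `Z` is non-empty). [cite: Zharkov2020TropicalWeil, §2] [cite: MikhalkinZharkov2014Eigenwave, Prop. 4.3] -/
theorem span_restrictedFrames_eq_top_of_offBoundary {Q : Matrix (Fin (2 * 4)) (Fin (2 * 4)) ℝ} (hQd : IsUnit Q.det)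
    (hJ : Q * weilJ 4 = weilJ 4 * Q) (Z : TropicalTorusCycle (2 * 4) 4 Q) (q0 q1 q2 : ℝ)
    (hq : TropicalTorusCycle.cyc Z = q0 • θ⟦4⟧ Q + q1 • wRe⟦4⟧ Q + q2 • wIm⟦4⟧ Q)
    (hq0 : q0 ≠ 0) (hoff : 64 * (q1 ^ 2 + q2 ^ 2) ≠ q0 ^ 2) :
    Submodule.span ℝ (Set.range fun σ : Fin Z.numCells => fun r : Fin 70 =>
      ((pluckerCoord (Z.cell σ).frame (Chk.wordOfRank r) : ℤ) : ℝ)) = ⊤ := by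
  classical
  rw [← Submodule.span_insert_zero]
  refine span_insert_eq_top_of_testVector _ 0 fun c hc _ => ?_
  exact restricted_annihilator_eq_zero_of_offBoundary hQd hJ Z _ _ _ hq hq0 hoff c
    fun σ => hc _ (Set.mem_range_self σ)

/-- **Off the boundary the frames span `⋀⁴ℝ⁸`:** for an effective tropical `4`-cycle with a representation
`cyc Z = q₀θ₄(Q) + q₁Re w(Q) + q₂Im w(Q)`, `q₀ ≠ 0`, `64(q₁²+q₂²) ≠ q₀²` (K3 coordinates at a Weil-generic period) (e.g. whenever `W(Z) = 0`, and for EVERY non-empty effective cycle if K1 holds),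
the Plücker vectors span all `70` dimensions, so there are `≥ 70` distinct `4`-directions and `≥ 70` cells; only on the
boundary circle of the calibration cone (the calibrated case `|W| = μ`) can the span drop to a hyperplane.
[cite: Zharkov2020TropicalWeil, §2] [cite: MikhalkinZharkov2014Eigenwave, Prop. 4.3 and Thm. 5.4] -/
theorem finrank_span_frames_ge_of_offBoundary {Q : Matrix (Fin (2 * 4)) (Fin (2 * 4)) ℝ} (hQd : IsUnit Q.det)
    (hJ : Q * weilJ 4 = weilJ 4 * Q) (Z : TropicalTorusCycle (2 * 4) 4 Q) (q0 q1 q2 : ℝ)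
    (hq : TropicalTorusCycle.cyc Z = q0 • θ⟦4⟧ Q + q1 • wRe⟦4⟧ Q + q2 • wIm⟦4⟧ Q)
    (hq0 : q0 ≠ 0) (hoff : 64 * (q1 ^ 2 + q2 ^ 2) ≠ q0 ^ 2) :
    70 ≤ Module.finrank ℝ (Submodule.span ℝ (Set.range fun σ : Fin Z.numCells =>
      fun S : Fin 4 → Fin (2 * 4) => ((pluckerCoord (Z.cell σ).frame S : ℤ) : ℝ))) ∧ 70 ≤ Z.numCells := by
  classical
  have htop := span_restrictedFrames_eq_top_of_offBoundary hQd hJ Z q0 q1 q2 hq hq0 hoff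
  set P : Fin Z.numCells → ((Fin 4 → Fin (2 * 4)) → ℝ) :=
    fun σ S => ((pluckerCoord (Z.cell σ).frame S : ℤ) : ℝ) with hP
  set ρ : ((Fin 4 → Fin (2 * 4)) → ℝ) →ₗ[ℝ] (Fin 70 → ℝ) :=
    LinearMap.funLeft ℝ ℝ (fun r : Fin 70 => Chk.wordOfRank r) with hρ
  have hrange : (Set.range fun σ : Fin Z.numCells => fun r : Fin 70 =>
      ((pluckerCoord (Z.cell σ).frame (Chk.wordOfRank r) : ℤ) : ℝ)) = ρ '' Set.range P := by
    rw [← Set.range_comp]; rfl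
  have h70 : Module.finrank ℝ (Fin 70 → ℝ) = 70 := Module.finrank_fin_fun ℝ
  have h1 : Module.finrank ℝ (Submodule.span ℝ (ρ '' Set.range P)) = 70 := by
    rw [← hrange, htop, finrank_top, h70]
  have h3 : Module.finrank ℝ (Submodule.span ℝ (ρ '' Set.range P)) ≤
      Module.finrank ℝ (Submodule.span ℝ (Set.range P)) := by
    rw [Submodule.span_image]
    exact Submodule.finrank_map_le ρ _
  have h4 : Module.finrank ℝ (Submodule.span ℝ (Set.range P)) ≤ (Set.range P).toFinset.card :=
    finrank_span_le_card _
  rw [Set.toFinset_range] at h4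
  have h5 := Finset.card_image_le (s := (Finset.univ : Finset (Fin Z.numCells))) (f := P)
  simp only [Finset.card_univ, Fintype.card_fin] at h5
  exact ⟨by omega, by omega⟩

/-! ### The case `W(Z) = 0` (what K1 predicts): the frames span everything -/

/-- If `W(Z) = 0`, the restricted Plücker vectors of the non-empty effective cycle `Z` (Weil-generic `Q`) span `ℝ⁷⁰`
(`cyc Z = r θ₄(Q)`, p329881, is off the cone boundary). [cite: Zharkov2020TropicalWeil, §2]
[cite: MikhalkinZharkov2014Eigenwave, Prop. 4.3] -/
theorem span_restrictedFrames_eq_top_of_weilFunctional_eq_zero (Q : Matrix (Fin (2 * 4)) (Fin (2 * 4)) ℝ)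
    (hQ : Q.PosDef) (hJ : Q * weilJ 4 = weilJ 4 * Q) (hgen : IsWeilGeneric 4 Q) (Z : TropicalTorusCycle (2 * 4) 4 Q)
    (hZ : 0 < Z.numCells) (hW : weilFunctional Z = 0) :
    Submodule.span ℝ (Set.range fun σ : Fin Z.numCells => fun r : Fin 70 =>
      ((pluckerCoord (Z.cell σ).frame (Chk.wordOfRank r) : ℤ) : ℝ)) = ⊤ := by
  obtain ⟨r, hr⟩ := cyc_eq_ratCast_smul_thetaClass_of_weilFunctional_eq_zero Q hQ hJ hgen Z hW
  have hQd : IsUnit Q.det := isUnit_iff_ne_zero.mpr hQ.det_pos.ne'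
  have hr0 : ((r : ℚ) : ℝ) ≠ 0 := by
    intro h0
    refine cyc_ne_zero Z hZ ?_
    rw [hr, h0, zero_smul]
  have hq' : TropicalTorusCycle.cyc Z = ((r : ℚ) : ℝ) • θ⟦4⟧ Q + (0 : ℝ) • wRe⟦4⟧ Q + (0 : ℝ) • wIm⟦4⟧ Q := by
    rw [hr, zero_smul, zero_smul, add_zero, add_zero]
  refine span_restrictedFrames_eq_top_of_offBoundary hQd hJ Z _ _ _ hq' hr0 ?_
  have : ((r : ℚ) : ℝ) ^ 2 ≠ 0 := pow_ne_zero 2 hr0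
  intro h; apply this; rw [← h]; ring

/-- **If `W(Z) = 0` the frames span `⋀⁴ℝ⁸`:** rank `≥ 70` (so exactly the `70` of `⋀⁴ℝ⁸`) and `≥ 70` cells with pairwise
distinct `4`-directions — for EVERY non-empty effective tropical `4`-cycle on the very general tropical Weil eightfold if the
open crux K1 (`TropicalWeilVanishing`) holds. [cite: Zharkov2020TropicalWeil, §2] [cite: MikhalkinZharkov2014Eigenwave, Prop. 4.3] -/
theorem finrank_span_frames_ge_of_weilFunctional_eq_zero (Q : Matrix (Fin (2 * 4)) (Fin (2 * 4)) ℝ)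
    (hQ : Q.PosDef) (hJ : Q * weilJ 4 = weilJ 4 * Q) (hgen : IsWeilGeneric 4 Q) (Z : TropicalTorusCycle (2 * 4) 4 Q)
    (hZ : 0 < Z.numCells) (hW : weilFunctional Z = 0) :
    70 ≤ Module.finrank ℝ (Submodule.span ℝ (Set.range fun σ : Fin Z.numCells =>
      fun S : Fin 4 → Fin (2 * 4) => ((pluckerCoord (Z.cell σ).frame S : ℤ) : ℝ))) ∧ 70 ≤ Z.numCells := by
  obtain ⟨r, hr⟩ := cyc_eq_ratCast_smul_thetaClass_of_weilFunctional_eq_zero Q hQ hJ hgen Z hW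
  have hQd : IsUnit Q.det := isUnit_iff_ne_zero.mpr hQ.det_pos.ne'
  have hr0 : ((r : ℚ) : ℝ) ≠ 0 := by
    intro h0
    refine cyc_ne_zero Z hZ ?_
    rw [hr, h0, zero_smul]
  have hq' : TropicalTorusCycle.cyc Z = ((r : ℚ) : ℝ) • θ⟦4⟧ Q + (0 : ℝ) • wRe⟦4⟧ Q + (0 : ℝ) • wIm⟦4⟧ Q := by
    rw [hr, zero_smul, zero_smul, add_zero, add_zero]
  refine finrank_span_frames_ge_of_offBoundary hQd hJ Z _ _ _ hq' hr0 ?_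
  have : ((r : ℚ) : ℝ) ^ 2 ≠ 0 := pow_ne_zero 2 hr0
  intro h; apply this; rw [← h]; ring

end Summit.HodgeConjecture.HodgeConjecture.Theorems.TropicalWeilVanishing.FrameSpan

end
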